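import Summits.BirchSwinnertonDyer.Rank1Residual.X11b.Three.HsiehDescentReciprocityPrelude
import Summits.BirchSwinnertonDyer.Rank1Residual.X11b.UnramifiedInertiaFixed
import Summits.BirchSwinnertonDyer.Rank1Residual.X11b.AnticyclotomicEmbedding
import HarnessLib

/-!
# X11b @ `p = 3`, S29/S30 K4′-b: value reciprocity (VR) IMPLIES value reciprocity LOCAL AT 3
# (VR_loc) — the local terminal form's hypothesis is WEAKER than K4's, as a kernel theorem

HONEST FRAMING (cell `b2b-bsdres`, run/shared/lean/b2b/bsd-rank1-residual/, verbatim in every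
file): the goal of the cell is to DELETE the COMBINATION-SHAPED residual classes of the
Birch–Swinnerton-Dyer formula for ALL analytic-rank `≤ 1` elliptic curves over `ℚ` — assembled
STRICTLY from published theorems — so that the rank-`≤ 1` remainder becomes exactly the
CONSTRUCTION-SHAPED classes, which are TYPED, NOT attempted. This is not "finishing BSD". Team N8/O2
(X11b at `3`); deal K4′ (x11b3-lead GEN 9, OWNERS R10-7 (3) / R10-15), seat `b2b-bsdres-x11b3-p7`
(gen. 6). **WORDING OF RECORD (H45, R10-15 (2)): K4′ RE-EXPRESSES (t) ⟸ (VR_loc); (VR_loc) = value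
reciprocity LOCAL AT 3 — an OPEN labelled hypothesis, WEAKER than (VR) by THIS file's kernel lemma.**
Both (VR) (= `hVR`, x11b3-r1's `K4InlineShape` v3, the hypothesis of K4 p286080 / p287576) and
(VR_loc) (= `hVRloc`, x11b3-p7's S30-d §4(b), gate-read by x11b3-r1 GEN 14 (PASS, scratch
554cc499afe09efd), the hypothesis of K4′-a) are LABELLED HYPOTHESES — NOT published numbered
theorems; this file proves the IMPLICATION between them and discharges neither. The node
`Three.HsiehDescentAt₃` is UNCHANGED — nothing appended, no `_holds`; O2 OPEN / N8 CONSTRUCTION;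
nothing booked; no mark / label / count / tier moved. THEOREMS ONLY (no definition, no named fact,
no `sorry`).

## What this file proves

* **`Three.localValueReciprocity_of_valueReciprocity : hVR → hVRloc`** (K4′-b). Decomposition clause:
  an automorphism `σ` of `ℂ` lying over `τ ∈ Gal(ℚ̄₃/ℚ₃)` through `ι′` (`σ ∘ ι′ = ι′ ∘ τ`) fixes every
  complex embedding of the quadratic field `K` — because `K ↪ ℚ₃` at the split prime `𝔭` (K1
  `embAt`) and `τ` is `ℚ₃`-linear (K1 prelude `algEquiv_apply_embedding_eq`) — so hVR's (VR-A)
  applies to it (the idle support condition on the monomial is discarded). Inertia clause: for `τ`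
  fixing the prime-to-`3` roots of unity, T6 (x11b3-p5's
  `UnramifiedInertia.apply_symm_eq_of_forall_rootsOfUnity_of_ramificationIdx_eq_one`) makes `τ` fix
  `ι′⁻¹(F)` for hVR's number field `F` unramified above `3`, hence `σ` fixes `F` pointwise and hVR's
  (VR-B) gives exactness.
* The converse (VR_loc) ⟹ (VR) is NOT claimed. The consumer K4′-a
  (`Three.hsiehDescentAt₃_of_localValueReciprocity : hVRloc → HsiehDescentAt₃ W`, file
  `HsiehDescentOfLocalReciprocity`, which imports this one) takes this file's conclusion as its
  hypothesis VERBATIM and recovers K4's terminal form `hVR → HsiehDescentAt₃ W` (p287576) as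
  K4′-a ∘ K4′-b (`Three.hsiehDescentAt₃_of_valueReciprocity_viaLocal`, record only).

References: cell files OWNERS R10-7 (3), R10-15; x11b3-p7 `s25/S30-SIGMA-SITES.md` §4(b); x11b3-r1
`S30-VR-SPLIT.md` §3; [SerreLocalFields1979] Ch. IV §4; [Tate1967] §3.3; [Hsieh2014] Thm. 1.
-/

noncomputable section

open scoped NumberField
open NumberField IsDedekindDomain Field WeierstrassCurve
open Literature.NumberTheory.GaloisRepresentations Literature.NumberTheory.EllipticCurves
open Literature.NumberTheory.EllipticCurves.ModularForms
open Summit.BirchSwinnertonDyer.Rank1Residual.X11b.Three.RangeTransport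

namespace Summit.BirchSwinnertonDyer.Rank1Residual.X11b.Three

variable (W : WeierstrassCurve ℚ)

/-- **K4′-b (comparison): value reciprocity (VR) implies value reciprocity LOCAL AT 3 (VR_loc).**
Both sides are LABELLED HYPOTHESES (nothing is discharged): `hVR` = K4's binder (p286080 l.79–104)
VERBATIM; the conclusion = K4′-a's binder `hVRloc` VERBATIM (`ι′` outermost as in the node, nine
node guards, then `∃ Ω ≠ 0 ∧ (VR-A_𝔭) ∧ (VR-B_I)`). Decomposition clause: a `σ` with `σ ∘ ι′ = ι′ ∘ τ` fixes every
complex embedding of the quadratic `K` (K1 prelude `algEquiv_apply_embedding_eq` + `embAt`, since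
`K_𝔭 = ℚ₃`), so (VR-A) applies; inertia clause: T6
(`UnramifiedInertia.apply_symm_eq_of_forall_rootsOfUnity_of_ramificationIdx_eq_one`) makes such a `σ`
fix `F` pointwise when `τ` is in inertia, so (VR-B) applies. (VR_loc) is IMPLIED BY (VR); the
converse is not claimed. WORDING OF RECORD: K4′ RE-EXPRESSES (t) ⟸ (VR_loc).
[cite: SerreLocalFields1979, Ch. IV §4 Cor. 2 to Prop. 16] [cite: Tate1967, §3.3 Theorem 2] -/
theorem localValueReciprocity_of_valueReciprocity
    (hVR :
  (∀ (K : Type) [Field K] [NumberField K] (𝔭 : HeightOneSpectrum (𝓞 K)) {N : ℕ} [NeZero N]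
      (f : CuspForm (CongruenceSubgroup.Gamma0 N) 2),
      IsNewformOf W f → W.conductorNorm ℤ = N → IsImaginaryQuadratic K → SatisfiesHeegnerHypothesis N K →
      ((Ideal.span {(3 : ℤ)}).primesOver (𝓞 K)).ncard = 2 → ((3 : ℕ) : 𝓞 K) ∈ 𝔭.asIdeal →
      ∃ Ω : ℂ, Ω ≠ 0 ∧
        -- (VR-A) cocycle clause on Aut(ℂ/K); ideal slot = integer-exponent monomial at primes v ∤ 3 (F-i)
        (∀ σ : ℂ ≃ₐ[ℚ] ℂ, (∀ (φ : K →+* ℂ) (k : K), σ (φ k) = φ k) →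
          ∃ (c d : ℂ) (e : HeightOneSpectrum (𝓞 K) →₀ ℤ), c ≠ 0 ∧ d ≠ 0 ∧
            (∀ v ∈ e.support, ((3 : ℕ) : 𝓞 K) ∉ v.asIdeal) ∧
            ∀ (χ : HeckeCharacter K) (n : ℕ), 0 < n →
              (∀ v : HeightOneSpectrum (𝓞 K), χ.IsUnramifiedAt v) →
              ∀ hχ : χ.HasInfinityType (fun _ ↦ (n : ℤ)) (fun _ ↦ -(n : ℤ)),
                σ (bdpInterpolationValue 3 f 𝔭 χ n Ω) =
                  d * c ^ n * (e.prod fun v k ↦ (hχ.autConj σ).valueAtUniformizer v ^ k) *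
                    bdpInterpolationValue 3 f 𝔭 (hχ.autConj σ) n Ω) ∧
        -- (VR-B) exactness clause on Aut(ℂ/F), F ⊇ K a number field unramified above 3
        (∃ F : IntermediateField ℚ ℂ, FiniteDimensional ℚ F ∧
          (∀ (φ : K →+* ℂ) (k : K), φ k ∈ F) ∧
          (∀ P : Ideal (𝓞 F), P.IsPrime → ((3 : ℕ) : 𝓞 F) ∈ P → P.ramificationIdx (𝓞 ℚ) = 1) ∧
          ∀ σ : ℂ ≃ₐ[ℚ] ℂ, (∀ x : ℂ, x ∈ F → σ x = x) →
            ∀ (χ : HeckeCharacter K) (n : ℕ), 0 < n →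
              (∀ v : HeightOneSpectrum (𝓞 K), χ.IsUnramifiedAt v) →
              ∀ hχ : χ.HasInfinityType (fun _ ↦ (n : ℤ)) (fun _ ↦ -(n : ℤ)),
                σ (bdpInterpolationValue 3 f 𝔭 χ n Ω) =
                  bdpInterpolationValue 3 f 𝔭 (hχ.autConj σ) n Ω))) :
    -- hVRloc — value reciprocity LOCAL AT 3 (S30-d §4(b)), ι′ outermost as in the node
    ∀ (ι' : PadicAlgCl 3 ≃+* ℂ) (K : Type) [Field K] [NumberField K] (𝔭 : HeightOneSpectrum (𝓞 K))
      {N : ℕ} [NeZero N] (f : CuspForm (CongruenceSubgroup.Gamma0 N) 2),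
      IsNewformOf W f → W.conductorNorm ℤ = N → IsImaginaryQuadratic K → SatisfiesHeegnerHypothesis N K →
      ((Ideal.span {(3 : ℤ)}).primesOver (𝓞 K)).ncard = 2 → ((3 : ℕ) : 𝓞 K) ∈ 𝔭.asIdeal →
      𝔭.asIdeal.ramificationIdx (𝓞 ℚ) = 1 → 𝔭.asIdeal.inertiaDeg (𝓞 ℚ) = 1 →
      (∀ (w : InfinitePlace K) (k : 𝓞 K), k ∈ 𝔭.asIdeal ↔ ‖ι'.symm (w.embedding (k : K))‖ < 1) →
      ∃ Ω : ℂ, Ω ≠ 0 ∧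
        -- (VR-A_𝔭) cocycle clause on the decomposition group at 𝔭 (transported by ι′); NO support condition
        (∀ (τ : PadicAlgCl 3 ≃ₐ[ℚ_[3]] PadicAlgCl 3) (σ : ℂ ≃ₐ[ℚ] ℂ),
          (∀ z : PadicAlgCl 3, σ (ι' z) = ι' (τ z)) →
          ∃ (c d : ℂ) (e : HeightOneSpectrum (𝓞 K) →₀ ℤ), c ≠ 0 ∧ d ≠ 0 ∧
            ∀ (χ : HeckeCharacter K) (n : ℕ), 0 < n →
              (∀ v : HeightOneSpectrum (𝓞 K), χ.IsUnramifiedAt v) →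
              ∀ hχ : χ.HasInfinityType (fun _ ↦ (n : ℤ)) (fun _ ↦ -(n : ℤ)),
                σ (bdpInterpolationValue 3 f 𝔭 χ n Ω) =
                  d * c ^ n * (e.prod fun v k ↦ (hχ.autConj σ).valueAtUniformizer v ^ k) *
                    bdpInterpolationValue 3 f 𝔭 (hχ.autConj σ) n Ω) ∧
        -- (VR-B_I) exactness clause on the inertia subgroup (T6's inertia predicate verbatim)
        (∀ (τ : PadicAlgCl 3 ≃ₐ[ℚ_[3]] PadicAlgCl 3) (σ : ℂ ≃ₐ[ℚ] ℂ),
          (∀ ζ : PadicAlgCl 3, (∃ m : ℕ, 0 < m ∧ ¬ 3 ∣ m ∧ ζ ^ m = 1) → τ ζ = ζ) →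
          (∀ z : PadicAlgCl 3, σ (ι' z) = ι' (τ z)) →
          ∀ (χ : HeckeCharacter K) (n : ℕ), 0 < n →
            (∀ v : HeightOneSpectrum (𝓞 K), χ.IsUnramifiedAt v) →
            ∀ hχ : χ.HasInfinityType (fun _ ↦ (n : ℤ)) (fun _ ↦ -(n : ℤ)),
              σ (bdpInterpolationValue 3 f 𝔭 χ n Ω) =
                bdpInterpolationValue 3 f 𝔭 (hχ.autConj σ) n Ω) := by
  intro ι' K _ _ 𝔭 N _ f hf hN hKiq hHeeg hsplit h3𝔭 hram hdeg _
  obtain ⟨Ω, hΩ, hVRA, F, hFfin, -, hF3, hVRB⟩ := hVR K 𝔭 f hf hN hKiq hHeeg hsplit h3𝔭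
  have hK2 : Module.finrank ℚ K = 2 := hKiq.1
  -- a `σ` over `τ` fixes every complex embedding of `K` (K_𝔭 = ℚ₃)
  have hσK : ∀ (τ : PadicAlgCl 3 ≃ₐ[ℚ_[3]] PadicAlgCl 3) (σ : ℂ ≃ₐ[ℚ] ℂ),
      (∀ z : PadicAlgCl 3, σ (ι' z) = ι' (τ z)) → ∀ (φ' : K →+* ℂ) (k : K), σ (φ' k) = φ' k := by
    intro τ σ hστ φ' k
    have h1 := algEquiv_apply_embedding_eq hK2 (embAt K 3 𝔭 h3𝔭 hram hdeg) τ
      (ι'.symm.toRingHom.comp φ') k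
    have h2 := hστ (ι'.symm (φ' k))
    rw [ι'.apply_symm_apply] at h2
    rw [h2]
    change ι' (τ (ι'.symm (φ' k))) = φ' k
    rw [show τ (ι'.symm (φ' k)) = ι'.symm (φ' k) from h1, ι'.apply_symm_apply]
  -- a `σ` over an INERTIAL `τ` fixes `F` pointwise (T6)
  have hσF : ∀ (τ : PadicAlgCl 3 ≃ₐ[ℚ_[3]] PadicAlgCl 3) (σ : ℂ ≃ₐ[ℚ] ℂ),
      (∀ ζ : PadicAlgCl 3, (∃ m : ℕ, 0 < m ∧ ¬ 3 ∣ m ∧ ζ ^ m = 1) → τ ζ = ζ) →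
      (∀ z : PadicAlgCl 3, σ (ι' z) = ι' (τ z)) → ∀ x : ℂ, x ∈ F → σ x = x := by
    intro τ σ hτ hστ x hx
    have h := UnramifiedInertia.apply_symm_eq_of_forall_rootsOfUnity_of_ramificationIdx_eq_one 3
      ι' F hFfin hF3 τ hτ x hx
    calc σ x = σ (ι' (ι'.symm x)) := by rw [ι'.apply_symm_apply]
      _ = ι' (τ (ι'.symm x)) := hστ _
      _ = x := by rw [h, ι'.apply_symm_apply]
  refine ⟨Ω, hΩ, fun τ σ hστ ↦ ?_, fun τ σ hτ hστ χ n hn hunr hχ ↦ hVRB σ (hσF τ σ hτ hστ) χ n hn hunr hχ⟩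
  obtain ⟨c, d, e, hc, hd, -, h⟩ := hVRA σ (hσK τ σ hστ)
  exact ⟨c, d, e, hc, hd, h⟩


end Summit.BirchSwinnertonDyer.Rank1Residual.X11b.Three
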